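import Mathlib
import Summits.NavierStokesRegularity.NavierStokesRegularity.Theorems.FilamentSkeletonRssStadiumPlateauShortChord
import Summits.NavierStokesRegularity.NavierStokesRegularity.Theorems.FilamentSkeletonRssStadiumPlateauKernel
import Summits.NavierStokesRegularity.NavierStokesRegularity.Theorems.FilamentSkeletonRssStadiumPlateauLog

/-!
# Route `FilamentSkeletonRss` · cruxes `SkeletonJ1L` (stmt-NavierStokesRegularity-23296, registered stub `stub_tangentSkeletonL` ≡
# `TangentSkeletonNearStraightL`, stmt-23320) · line `child_tangent_analytic_strip_L` (b0b56c52900dd90a), stub `stub_stripPropagation` —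
# brick for the BOUND clause of `rcore`: THE PLATEAU OF THE SYMMETRIC QUARTER-WIDTH TENT IS `O(log hs / hs)`

The plateau of the symmetric tent of a target `z = τ + iy` of the quarter stadium (`|y| < hs/4`, `|τ − cc| < L + hs/4`) is the horizontal chord
`σ + iy`, `σ ∈ [τ − hs/5, τ + hs/5]`, THROUGH the target.  With `‖F′‖ ≤ 2`, `Σ (F′)ᵢ² = 1` and NO hypothesis on the tangent oscillation, closed discs
of radius `hs/2` about the chord stay in the stadium, so the second-order chord estimate `Theorems.StadiumPlateauShortChord.plateau_chord_sq_sub_sq_le`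
gives the RELATIVE MARGIN `(21/25)(σ − τ)² ≤ Re Σᵢ (Fᵢ(σ + iy) − Fᵢ z)²` (`quarter_plateau_re_ge`); `Theorems.StadiumPlateauKernel.plateau_kernel_norm_le`
gives the pointwise majorant and `Theorems.StadiumPlateauLog.plateau_integral_norm_le` integrates it:
  `‖∫_{τ−hs/5}^{τ+hs/5} K(z, σ + iy) dσ‖ ≤ 4·(2·(2/(hs/2)))·(1/3 + log((2hs/5)·√(21/25)/μ))/(21/25)^{3/2}`,  `μ = √(κ/(2Λ))`,
provided `μ/√(21/25) ≤ 2hs/5` (`quarter_plateau_norm_le`) — the plateau part of the explicit own-term bound of `rcore`, `O(log hs/hs)`.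
HONEST FRAMING: a brick for the bookkeeping of a HYPOTHETICAL filament skeleton on the NEGATIVE side of a MODEL route; the stub `stub_stripPropagation`
is NOT closed by this file, `TangentSkeletonNearStraightL` / `SkeletonJ1L` stay OPEN; nothing here bears on Navier–Stokes regularity or blow-up.
`--supports stmt-NavierStokesRegularity-23320` (≡ stub `stub_tangentSkeletonL` of 23296).
-/

set_option linter.dupNamespace false

noncomputable section

namespace Summit.NavierStokesRegularity.NavierStokesRegularity.Theorems.StadiumQuarterPlateauBound

open Set Metric MeasureTheory
open scoped InnerProductSpace Matrix
open Summit.NavierStokesRegularity.NavierStokesRegularity.Theorems.StadiumPlateauShortChord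
open Summit.NavierStokesRegularity.NavierStokesRegularity.Theorems.StadiumPlateauKernel
open Summit.NavierStokesRegularity.NavierStokesRegularity.Theorems.StadiumPlateauLog
open Summit.NavierStokesRegularity.NavierStokesRegularity.Theorems.StadiumPartnerPiece

/-- Closed discs of radius `hs/2` about the plateau of a quarter-stadium target stay in the stadium. [folklore] -/
theorem closedBall_plateau_subset {hs L cc τ y : ℝ} (hhs : 0 < hs) (hy : |y| < hs / 4) (hτ : |τ - cc| < L + hs / 4)
    {σ : ℝ} (hσ : σ ∈ Set.uIcc (τ - hs / 5) (τ + hs / 5)) :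
    closedBall ((σ : ℂ) + (y : ℂ) * Complex.I) (hs / 2) ⊆ {w : ℂ | |w.im| < hs ∧ |w.re - cc| < L + hs} := by
  intro w hw
  rw [mem_closedBall, dist_eq_norm] at hw
  rw [Set.uIcc_of_le (by linarith : τ - hs / 5 ≤ τ + hs / 5)] at hσ
  have him : |w.im - y| ≤ hs / 2 := by
    have h := Complex.abs_im_le_norm (w - ((σ : ℂ) + (y : ℂ) * Complex.I))
    simp only [Complex.sub_im, Complex.add_im, Complex.ofReal_im, Complex.mul_im, Complex.ofReal_re, Complex.I_re,
      Complex.I_im, mul_zero, mul_one, zero_add, add_zero] at h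
    simpa using h.trans hw
  have hre : |w.re - σ| ≤ hs / 2 := by
    have h := Complex.abs_re_le_norm (w - ((σ : ℂ) + (y : ℂ) * Complex.I))
    simp only [Complex.sub_re, Complex.add_re, Complex.ofReal_re, Complex.mul_re, Complex.ofReal_im, Complex.I_re,
      Complex.I_im, mul_zero, mul_one, sub_zero, add_zero] at h
    exact h.trans hw
  have hy' := abs_lt.mp hy
  have hτ' := abs_lt.mp hτ
  have him' := abs_le.mp him
  have hre' := abs_le.mp hre
  refine ⟨?_, ?_⟩
  · rw [abs_lt]; constructor <;> linarith
  · rw [abs_lt]; constructor <;> linarith [hσ.1, hσ.2]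

/-- **Relative margin `21/25` on the plateau of the symmetric quarter-width tent** (second order, no `Rb`): for `|s| ≤ hs/5`,
`(21/25)·s² ≤ Re Σᵢ (Fᵢ(z + s) − Fᵢ z)²`. [folklore] -/
theorem quarter_plateau_re_ge {hs L cc : ℝ} {F : ℂ → (Fin 3 → ℂ)}
    (hF : DifferentiableOn ℂ F {z : ℂ | |z.im| < hs ∧ |z.re - cc| < L + hs})
    (hM : ∀ z ∈ {z : ℂ | |z.im| < hs ∧ |z.re - cc| < L + hs}, ‖deriv F z‖ ≤ 2)
    (hunit : ∀ w ∈ {z : ℂ | |z.im| < hs ∧ |z.re - cc| < L + hs}, ∑ i, (deriv F w i) ^ 2 = 1)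
    (hhs : 0 < hs) {z : ℂ} (hy : |z.im| < hs / 4) (hτ : |z.re - cc| < L + hs / 4) {s : ℝ} (hs5 : |s| ≤ hs / 5) :
    (21 / 25 : ℝ) * s ^ 2 ≤ (∑ i, (F (z + (s : ℂ)) i - F z i) ^ 2).re := by
  have hy' := abs_lt.mp hy
  have hτ' := abs_lt.mp hτ
  have hs' := abs_le.mp hs5
  have h := plateau_chord_sq_sub_sq_le hF hM hunit (d := hs / 2) (z := z) (s := s) (by positivity)
    (by linarith) (by linarith)
    (by
      have h1 : |z.re + s - cc| ≤ |z.re - cc| + |s| := by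
        rw [show z.re + (s : ℝ) - cc = (z.re - cc) + s by ring]; exact abs_add_le _ _
      linarith)
  set Q : ℂ := ∑ i, (F (z + (s : ℂ)) i - F z i) ^ 2 with hQ
  have hre : Q.re = s ^ 2 + (Q - (s : ℂ) ^ 2).re := by
    simp [Complex.sub_re, ← Complex.ofReal_pow]
  have hlow : -((2 / (hs / 2)) ^ 2 / 4 * s ^ 4) ≤ (Q - (s : ℂ) ^ 2).re := by
    have h3 := Complex.abs_re_le_norm (Q - (s : ℂ) ^ 2)
    have h4 := neg_abs_le (Q - (s : ℂ) ^ 2).re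
    linarith
  have hs2 : s ^ 2 ≤ (hs / 5) ^ 2 := by
    have := sq_abs s; nlinarith [abs_nonneg s]
  have h4 : (2 / (hs / 2)) ^ 2 / 4 * s ^ 4 ≤ (4 / 25 : ℝ) * s ^ 2 := by
    have e : (2 / (hs / 2)) ^ 2 / 4 * s ^ 4 = (4 / hs ^ 2) * s ^ 2 * s ^ 2 := by
      field_simp; ring
    rw [e]
    have hhs2 : 0 < hs ^ 2 := by positivity
    have h5 : (4 / hs ^ 2) * s ^ 2 ≤ 4 / 25 := by
      rw [div_mul_eq_mul_div, div_le_iff₀ hhs2]; nlinarith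
    exact mul_le_mul_of_nonneg_right h5 (sq_nonneg s)
  rw [hre]; linarith

/-- **The plateau of the symmetric quarter-width tent is `O(log hs/hs)`.**  Stadium `S`, `F` holomorphic with `‖F′‖ ≤ 2`, `Σ (F′)ᵢ² = 1`; core
continuation with `Re G ≥ Λ⁻¹/2` on `S`; `κ, Λ > 0`; target `z = τ + iy` with `|y| < hs/4`, `|τ − cc| < L + hs/4`; the plateau log-condition
`√(κ/(2Λ))/√(21/25) ≤ 2hs/5`.  Then the plateau integral of the kernel of target `z` obeys the displayed `O(log)` bound. [folklore] -/
theorem quarter_plateau_norm_le {hs L cc κ Λ τ y : ℝ} {F : ℂ → (Fin 3 → ℂ)} {G : ℂ → ℂ}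
    (hF : DifferentiableOn ℂ F {z : ℂ | |z.im| < hs ∧ |z.re - cc| < L + hs})
    (hM : ∀ z ∈ {z : ℂ | |z.im| < hs ∧ |z.re - cc| < L + hs}, ‖deriv F z‖ ≤ 2)
    (hunit : ∀ w ∈ {z : ℂ | |z.im| < hs ∧ |z.re - cc| < L + hs}, ∑ i, (deriv F w i) ^ 2 = 1)
    (hGre : ∀ w ∈ {z : ℂ | |z.im| < hs ∧ |z.re - cc| < L + hs}, Λ⁻¹ / 2 ≤ (G w).re)
    (hκ : 0 < κ) (hΛ : 0 < Λ) (hhs : 0 < hs) (hy : |y| < hs / 4) (hτ : |τ - cc| < L + hs / 4)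
    (hR : √(κ / (2 * Λ)) / √(21 / 25 : ℝ) ≤ (τ + hs / 5) - (τ - hs / 5)) :
    ‖∫ σ in (τ - hs / 5)..(τ + hs / 5), (((∑ i, (F ((τ : ℂ) + (y : ℂ) * Complex.I) i - F ((σ : ℂ) + (y : ℂ) * Complex.I) i) ^ 2) +
          (κ : ℂ) * G ((σ : ℂ) + (y : ℂ) * Complex.I)) ^ ((3:ℂ) / 2))⁻¹ •
        (deriv F ((σ : ℂ) + (y : ℂ) * Complex.I) ⨯₃
          (fun i => F ((τ : ℂ) + (y : ℂ) * Complex.I) i - F ((σ : ℂ) + (y : ℂ) * Complex.I) i))‖ ≤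
      4 * (2 * (2 / (hs / 2))) * ((1/3 + Real.log (((τ + hs / 5) - (τ - hs / 5)) * √(21 / 25 : ℝ) / √(κ / (2 * Λ)))) /
        (21 / 25 : ℝ) ^ (3/2 : ℝ)) := by
  set S : Set ℂ := {z : ℂ | |z.im| < hs ∧ |z.re - cc| < L + hs} with hS
  have hSo : IsOpen S := isOpen_stadium hs (L + hs) cc
  set c : ℝ := (21 / 25 : ℝ) with hcdef
  have hc : 0 < c := by norm_num [hcdef]
  set μ : ℝ := √(κ / (2 * Λ)) with hμdef
  have hμpos : 0 < μ := Real.sqrt_pos.2 (by positivity)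
  have hμsq : μ ^ 2 = κ / (2 * Λ) := Real.sq_sqrt (by positivity)
  set z : ℂ := (τ : ℂ) + (y : ℂ) * Complex.I with hz
  have hzim : z.im = y := by simp [hz]
  have hzre : z.re = τ := by simp [hz]
  set a : ℝ := τ - hs / 5 with ha
  set b : ℝ := τ + hs / 5 with hb
  have hab : a ≤ b := by rw [ha, hb]; linarith
  have hτab : τ ∈ Icc a b := ⟨by rw [ha]; linarith, by rw [hb]; linarith⟩
  have huIcc : Set.uIcc a b = Icc a b := uIcc_of_le hab
  have hdisc : ∀ σ ∈ Set.uIcc a b, closedBall ((σ : ℂ) + (y : ℂ) * Complex.I) (hs / 2) ⊆ S := fun σ hσ =>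
    closedBall_plateau_subset hhs hy hτ hσ
  have hR₀ : (0:ℝ) < hs / 2 := by positivity
  -- pointwise majorant along the plateau
  have hdom : ∀ σ ∈ Icc a b, ‖(((∑ i, (F z i - F ((σ : ℂ) + (y : ℂ) * Complex.I) i) ^ 2) +
          (κ : ℂ) * G ((σ : ℂ) + (y : ℂ) * Complex.I)) ^ ((3:ℂ) / 2))⁻¹ •
        (deriv F ((σ : ℂ) + (y : ℂ) * Complex.I) ⨯₃ (fun i => F z i - F ((σ : ℂ) + (y : ℂ) * Complex.I) i))‖ ≤
      (c * (σ - τ) ^ 2 + μ ^ 2) ^ (-(3/2 : ℝ)) * (2 * 2 * (2 / (hs / 2)) * (σ - τ) ^ 2) := by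
    intro σ hσ
    set ζ : ℂ := (σ : ℂ) + (y : ℂ) * Complex.I with hζ
    have hζeq : z + ((σ - τ : ℝ) : ℂ) = ζ := by simp [hz, hζ]; ring
    have hs5 : |σ - τ| ≤ hs / 5 := by
      rw [abs_le]; constructor <;> [linarith [hσ.1, ha.symm]; linarith [hσ.2]]
    have hQ : c * (σ - τ) ^ 2 ≤ (∑ i, (F (z + ((σ - τ : ℝ) : ℂ)) i - F z i) ^ 2).re :=
      quarter_plateau_re_ge hF hM hunit hhs (by rw [hzim]; exact hy) (by rw [hzre]; exact hτ) hs5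
    have hτ' : τ ∈ Set.uIcc a b := by rw [huIcc]; exact hτab
    have hσ' : σ ∈ Set.uIcc a b := by rw [huIcc]; exact hσ
    have hk := plateau_kernel_norm_le hSo hF hM hR₀ hdisc hτ' hσ' hκ hΛ (le_refl Λ⁻¹) hc.le
      (hGre _ (hdisc σ hσ' (mem_closedBall_self hR₀.le))) hQ
    rw [hζeq] at hk
    have e1 : (∑ i, (F ζ i - F z i) ^ 2) = ∑ i, (F z i - F ζ i) ^ 2 := Finset.sum_congr rfl fun i _ => by ring
    have e2 : (F z - F ζ) = fun i => F z i - F ζ i := by funext i; simp [Pi.sub_apply]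
    rw [e1, e2] at hk
    have e3 : κ / (2 * Λ) = μ ^ 2 := hμsq.symm
    rw [e3] at hk
    exact hk
  have hBK : 0 ≤ 2 * (2 / (hs / 2)) := by positivity
  have h := plateau_integral_norm_le (E := Fin 3 → ℂ) hab hτab hc hμpos hR hBK
    (f := fun σ => (((∑ i, (F z i - F ((σ : ℂ) + (y : ℂ) * Complex.I) i) ^ 2) +
          (κ : ℂ) * G ((σ : ℂ) + (y : ℂ) * Complex.I)) ^ ((3:ℂ) / 2))⁻¹ •
        (deriv F ((σ : ℂ) + (y : ℂ) * Complex.I) ⨯₃ (fun i => F z i - F ((σ : ℂ) + (y : ℂ) * Complex.I) i)))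
    (fun σ hσ => by
      have := hdom σ hσ
      simpa [mul_assoc] using this)
  simpa [hz] using h

end Summit.NavierStokesRegularity.NavierStokesRegularity.Theorems.StadiumQuarterPlateauBound

end
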